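import Summits.QuantumFields.YangMills.Theorems.BalabanUVNodesN18HLayerW1Config

/-!
# BalabanUVNodes ∕ N18 — THE H-LAYER ACTIVITY DATUM IN THE CONFIGURATION DIRECTION AT ANY SPACE TABLE, IN PARTICULAR AT THE
# TABLE OF RECORD `W1.spaceOfRecord` (which is NOT open in `Φ`): the neighbourhood extension «W1's named pair (`AnalyticH`, `Bound238`)
# on a restriction-closed table + amplitude slack `A < A′` ⟹ route P1's LITERAL `hH` SHAPE at W1's objects (an OPEN `V ⊇ U^c_{k+1}(X)`
# carrying holomorphy and the (2.38)-majorant of every `H(·, Z)`, `Z ⊆ X`)», and from the `hH` shape [II] p. 15 + (2.39)–(2.41) ON THE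
# TABLE ITSELF: `E^{(k+1)}(X; g; ·)` analytic + (2.41)-bounded on `sp X`, `W1.TermAnalytic` + `W1.TermBound118`, the reading's `DecayBound`s
# (WHY in the kernel — the table of record at the SU(N) setting is SL(N,ℂ)-valued on the bonds of `X`, hence not open in `Φ` — is the companion
# file 11 `BalabanUVNodesN18HLayerW1SpaceNotOpen`)
# (Track A, DAG node N18 = NE5 `T4OutputRate.NE5 EA EB W κ θ C₅` :211; cluster K4 «SpineRates»; file 10 of seat pub-ymgap-dag-n18-c, row s1,
# generation 3; companion of file 9 `BalabanUVNodesN18HLayerW1Config` p470180)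

Cell `pub-ymgap`, HUMAN RULING D-0062 (Track A), R134 ACCELERATION seat `pub-ymgap-dag-n18-c` (strategy s1), generation 3.  THEOREMS ONLY
(no `def`, no `instance`, no `sorry`); imports file 9 only (through it n22-c's `…N22W1DerivBound` ∕ `…N22W1StripInduction`, the NE1′ faces,
W1's `Node00/RateRecordW1Reading` ∕ `Node00/HistoryTermsOfRecord`, `Literature/Analysis/Complex/HolomorphicBanach`); restates nothing.

WHY (located on re-reading `Node00.Sect2FrameOfRecord` after file 9 landed; bus LANDED-9 line).  File 9 proved the configuration-direction
passage «(2.13an) + (2.38) for `H` ⟹ `E^{(k+1)}` analytic + (2.41)-bounded» for space tables `sp` whose members are OPEN in `Φ = Sect2.CPair P 𝔸`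
(`hsp : IsOpen (sp X)`).  THE TABLE OF RECORD IS NOT OF THAT KIND: `W1.spaceOfRecord Sg Rz α₀ α₁ j X = Sect2.spaceI … = embedPair ''
B12RegularSpaces111.space' Sg.𝓜 …`, the union of `Gᶜ`-orbits of configurations satisfying [I] (1.11)–(1.16), and the record's model
`B12RegularSpaces111SpecialUnitary.suModel N` has `Gc := slUnits N`: every configuration of `U^c_j(X, α₀, α₁)` is SL(N, ℂ)-valued on the bonds of
`X`, so `U^c_j(X, α₀, α₁)` has EMPTY INTERIOR in `Φ` and `hsp` is unsatisfiable there (file 11 proves it in the kernel; file 9 stays non-vacuous at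
open neighbourhood tables and at `univ`).  W1's `AnalyticH` is the AMBIENT reading (`AnalyticOnNhd`: analytic at each point of the space in a `Φ`-neighbourhood; [II]
p. 15: the forms and covariances are «analytic functions on the space of configurations … with constants α′₀, α′₁ much bigger than α₀, α₁»), so
holomorphy near the space is in the hypothesis; the cluster expansion needs in addition the MAJORANT on a neighbourhood, which costs only an
amplitude slack: by continuity at the points of the space and FINITENESS of the torus catalogue `𝐃_{k+1}`, `‖H(φ, Z)‖ ≤ A·e^{−R d(Z)}` on the space
gives `≤ A′·e^{−R d(Z)}` on an open neighbourhood, any `A′ > A`.  The result is route P1's `hH` shape VERBATIM (`Spine/NE5/EnvelopeOnRecord`: «∃ open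
`V ⊇` box, every activity ℂ-differentiable on `V` and dominated by `A·e^{−R·d(Z)}` there») at W1's objects with the space `U^c_{k+1}(X)` in the rôle
of the box — the row's DATUM in the record's own currency — and from it the conclusions of file 9 ON THE TABLE ITSELF, with no openness hypothesis.

WHAT (theorems only; `open Classical` instances as in W1's `ClusterStep.E`, (2.13) matched by `rfl`).
* §1 `exists_nbhd_hLayer_of_analyticH_bound238` — THE NEIGHBOURHOOD EXTENSION, any torus `P`: `W1.SpRestr sp` + `S.AnalyticH Wk sp` +
  `S.Bound238 Wk sp A R` + `A < A′` ⟹ per `g ∈ Wk`, `X ∈ 𝐃_{k+1}` an OPEN `V ⊇ sp X` with every `φ ↦ S.H g φ Z`, `Z ⊆ X`, ℂ-differentiable on `V` and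
  `≤ A′·e^{−R d_{k+1}(Z)}` there (`V := ⋂_{Z ⊆ X} {analytic at φ ∧ ‖H φ Z‖ < A′e^{−R d(Z)}}`, open by `AnalyticAt.eventually_analyticAt`, continuity, finiteness).
* §2 `analyticOnNhd_and_bound_E_of_hLayer` — FROM THE `hH` SHAPE, ANY table, any `P`: `AnalyticOnNhd ℂ (φ ↦ S.E g φ X) (sp X)` ∧ the (2.41) bound
  `e·ν·c₁·K₀²·A·e^{−r₁ d_{k+1}(X)}` on `sp X` (NE1′ face on `V`, [Chae1985] on `V`, restriction to `sp X ⊆ V`); `le_of_forall_gt_amplitude` (the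
  slack is free: dominated by `L·A′·t` for all `A′` just above `A` ⟹ dominated by `L·A·t`); `…_of_bound238_table` = §2 ∘ §1 — W1's named pair on ANY
  restriction-closed table with the [KP86] clause in STRICT form `A·e^{5r₁+1}·K₀·ν·c₁ < 1` ⟹ file 9's conclusion VERBATIM (amplitude `A`).
* §3 AT `F.P K` WITH THE LOCATED NUMERALS, ANY TABLE (hence at `spaceOfRecord`), strict clause `A·e^{5r₁+1}·K₀(64,8)·9·64 < 1`:
  `analyticOnNhd_and_bound_E_of_bound238_table_four`, `termAnalytic_of_bound238_table` (`W1.TermAnalytic S W sp`), `termBound118_of_bound238_table`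
  (`W1.TermBound118 S W sp (e·9·64·K₀(64,8)²·A) r₁` — file 9's amplitude).
* §4 AT THE W1 READING, ANY TABLE: `decayBound_EA_of_bound238_table` ∕ `decayBound_EB_of_bound238_table` (`DecayBound (R.EA S) ∕ (R.EB S′ b) (Window γ)
  (e·9·64·K₀(64,8)²·A) r₁` at a level pairing `R` — NE5's leaves L05∕L06, readings inside the table, pairing datum `hpair` displayed as in file 9) and
  §4b the same at `ReadingData.u3Objects` (`decayBound_u3Objects_EA ∕ EB_of_bound238_table`, `rfl` faces of `RateRecordW1Reading`).
* (file 11 `BalabanUVNodesN18HLayerW1SpaceNotOpen`, LOCATED IN THE KERNEL: at `Node00.settingOfRecord₁₂` — `suModel N`, `Gᶜ = slUnits N` — the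
  table of record `W1.spaceOfRecord` is SL(N,ℂ)-valued on the bonds of `X`, hence, when non-empty and `X` holds a bond, NOT open in `Φ`.)

HONEST FRAMING — what this is NOT.  Count-neutral kernel bookkeeping ([KP86] via the NE1′ face, [Chae1985] via `HolomorphicBanach`, elementary
topology); NOT a discharge of N18 (typed 28∕28 · discharged 5∕27 UNCHANGED).  `AnalyticH` ∕ `Bound238` per step remain W1's named HYPOTHESES for
THE (2.14) terms of record (N10's Lemmas 1–3 ∕ NODE A ∕ NODE O content), asserted nowhere; the readings landing in the spaces (`hembA ∕ hembB`, [I]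
p. 263, Theorem-1 content), the restriction property of the table and the pairing datum `hpair` are DISPLAYED; the STRICT [KP86] clause is the
honest price of reading (2.38) on the space only (the neighbourhood carries `A′e^{−Rd}` for `A′ > A`; print's (2.39)–(2.40) is a smallness of `ε₁`,
strictness immaterial).  The non-openness of `spaceOfRecord` is PROVED in file 11 from the definitions `Sect2.spaceI`, `B12RegularSpaces111.space'`,
`suModel.Gc = slUnits N` (non-emptiness and a bond in `X` displayed there).  A consequence for the (1.17) face (n22-c `termDerivBound_of_termBound118`): its margin
hypothesis `ball φ ρ ⊆ sp j X` is likewise unsatisfiable AT `spaceOfRecord` and wants an open neighbourhood table — LOCATED, not repaired here.  NE5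
(the η-rate) untouched; NOT IN PRINT, NOT PROVED.  One finite four-torus programme at fixed `ε`, Bałaban as printed — NOT the continuum limit on
ℝ⁴, NOT infinite volume, NOT OS, NOT a mass gap, NOT Clay.  0 `sorry`, 0 `def`; axioms standard.

References (TYPES ∕ loci only): [I] = [Balaban1987RG1] CMP **109** (1987) — (0.24)–(0.25) p. 257, (1.11)–(1.16) p. 262, (1.17)–(1.18) + the
analyticity sentence p. 263; [II] = [Balaban1988RG2Cluster] CMP **116** (1988) — (2.9)–(2.14) pp. 14–15 (analyticity statement p. 15), Lemma 3
(2.38) p. 20, (2.39)–(2.41) p. 21; [KoteckyPreiss1986] CMP **103** (1986) Thm p. 492; [Chae1985] Thm 14.13.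
-/

noncomputable section

namespace Summit.QuantumFields.YangMills.BalabanUVNodes.N18HLayerW1ConfigRecord

open Set Metric Filter Topology
open scoped BigOperators
open Literature.MathematicalPhysics.QuantumFieldTheory.Balaban1983to89
open Literature.MathematicalPhysics.QuantumFieldTheory.Balaban1983to89.T4Continuum (T4Family)
open Literature.MathematicalPhysics.QuantumFieldTheory.Balaban1983to89.T4OutputRate
open Literature.MathematicalPhysics.QuantumFieldTheory.Balaban1983to89.TreeLengthTorus (TPt TDom tsys torusTreeLen torusTreeLen_nonneg)
open Literature.MathematicalPhysics.QuantumFieldTheory.Balaban1983to89.TreeLengthTorusGeometry (TTouch tgeometry tgeometry_consts)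
open Literature.MathematicalPhysics.QuantumFieldTheory.Balaban1983to89.B12TreeDecay (K₀ K₀_pos kappa₀)
open Literature.MathematicalPhysics.QuantumFieldTheory.Balaban1983to89.Node00
open Literature.MathematicalPhysics.QuantumFieldTheory.Balaban1983to89.Node00.Sect2 (domSys domCount CPair)
open Literature.MathematicalPhysics.QuantumFieldTheory.Balaban1983to89.Node00.W1
open Summit.QuantumFields.BalabanUV.T4Continuum.NE1p.DressedOutputAnalyticFaces (analytic_and_bounded_locE_param_of_geometry)
open Literature.Analysis.Complex.HolomorphicBanach (analyticOnNhd_of_differentiableOn)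
open YMDAG.N22.W1 (decayBound_functionalOn_of_termBound118)
open Summit.QuantumFields.YangMills.BalabanUVNodes.N18HLayerW1Config (tgeometry_consts_FP prependCoupling_mem_window)

/-! ## §1 The neighbourhood extension: W1's named pair on any restriction-closed table ⟹ route P1's `hH` shape at W1's objects -/

section Nbhd

variable {P : Params} {𝔸 : Type*} [NormedRing 𝔸] [NormedAlgebra ℂ 𝔸] {M k : ℕ}

/-- **THE NEIGHBOURHOOD EXTENSION.**  For W1's one-step data `S` at step `k`, a young-coupling set `Wk` and ANY space table `sp` on `𝐃_{k+1}` with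
the restriction property of [II] p. 15 (`hrestr : W1.SpRestr sp`; `sp X` NOT assumed open — e.g. the table of record `W1.spaceOfRecord …`, whose
members are SL(N,ℂ)-valued on the bonds of `X` at the SU(N) model and hence not open in `Φ`): the named pair «activities analytic at the points
of the spaces» (`han : S.AnalyticH Wk sp`, the AMBIENT reading of (2.13an)) and «(2.38) on the spaces» (`h238 : S.Bound238 Wk sp A R`) with an
amplitude slack `A < A′` give, for every `g ∈ Wk` and `X ∈ 𝐃_{k+1}`, an OPEN `V ⊇ sp X` on which every activity `φ ↦ S.H g φ Z`, `Z ⊆ X`, is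
ℂ-differentiable and dominated by `A′·e^{−R d_{k+1}(Z)}` — route P1's H-layer datum shape (`Spine/NE5/EnvelopeOnRecord`) at W1's objects, the
space in the rôle of the box.  Proof: `V := ⋂_{Z ⊆ X} {φ | analytic at φ ∧ ‖S.H g φ Z‖ < A′e^{−R d(Z)}}` — a finite intersection (the torus
catalogue `𝐃_{k+1}` is finite) of sets open by `AnalyticAt.eventually_analyticAt` and continuity; `sp X ⊆ V` by `SpRestr` and `A < A′`. [folklore] -/
theorem exists_nbhd_hLayer_of_analyticH_bound238 (S : ClusterStep P 𝔸 M k) (Wk : Set (Fin (k + 1) → ℝ))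
    (sp : (domSys P M (k + 1)).Dom → Set (CPair P 𝔸)) {A A' R : ℝ} (hrestr : W1.SpRestr sp) (han : S.AnalyticH Wk sp)
    (h238 : S.Bound238 Wk sp A R) (hAA' : A < A') :
    ∀ g ∈ Wk, ∀ X : (domSys P M (k + 1)).Dom, ∃ V : Set (CPair P 𝔸), IsOpen V ∧ sp X ⊆ V ∧
      (∀ Z : (domSys P M (k + 1)).Dom, Z.1 ⊆ X.1 → DifferentiableOn ℂ (fun φ => S.H g φ Z) V) ∧
      (∀ φ ∈ V, ∀ Z : (domSys P M (k + 1)).Dom, Z.1 ⊆ X.1 →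
        ‖S.H g φ Z‖ ≤ A' * Real.exp (-(R * (domSys P M (k + 1)).dj Z))) := by
  intro g hg X
  -- the good set of one polymer `Z` (analytic at the point, strictly under the enlarged majorant) is open
  have hT : ∀ Z : (domSys P M (k + 1)).Dom, IsOpen {φ : CPair P 𝔸 | AnalyticAt ℂ (fun ψ => S.H g ψ Z) φ ∧
      ‖S.H g φ Z‖ < A' * Real.exp (-(R * (domSys P M (k + 1)).dj Z))} := fun Z =>
    isOpen_iff_mem_nhds.2 fun φ hφ =>
      hφ.1.eventually_analyticAt.and (hφ.1.continuousAt.norm.eventually_lt continuousAt_const hφ.2)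
  refine ⟨⋂ Z ∈ {Z : (domSys P M (k + 1)).Dom | Z.1 ⊆ X.1}, {φ : CPair P 𝔸 | AnalyticAt ℂ (fun ψ => S.H g ψ Z) φ ∧
      ‖S.H g φ Z‖ < A' * Real.exp (-(R * (domSys P M (k + 1)).dj Z))},
    (Set.toFinite _).isOpen_biInter fun Z _ => hT Z, fun φ hφ => ?_, fun Z hZ φ hφ => ?_, fun φ hφ Z hZ => ?_⟩
  · -- the space on `X` lies in `V`: analyticity at its points and (2.38) on `sp Z ⊇ sp X`, with the slack `A < A′`
    refine mem_iInter₂.2 fun Z hZ => ⟨han g hg Z φ (hrestr X Z hZ hφ), ?_⟩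
    exact (h238 g hg Z φ (hrestr X Z hZ hφ)).trans_lt (mul_lt_mul_of_pos_right hAA' (Real.exp_pos _))
  · exact ((mem_iInter₂.1 hφ Z) hZ).1.differentiableAt.differentiableWithinAt
  · exact ((mem_iInter₂.1 hφ Z) hZ).2.le

end Nbhd

/-! ## §2 From the `hH` shape, on ANY table: `E^{(k+1)}(X; g; ·)` analytic on `sp X` and (2.41)-bounded there -/

section FromHLayer

variable {P : Params} {𝔸 : Type*} [NormedRing 𝔸] [NormedAlgebra ℂ 𝔸] {M k : ℕ}

open Classical in
/-- **[II] p. 15 + (2.39)–(2.41) p. 21 FROM THE `hH`-SHAPED DATUM, ON ANY SPACE TABLE.**  For W1's one-step data `S`, a young-coupling set `Wk` and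
ANY table `sp` (no openness, no restriction property): IF for every `g ∈ Wk` and `X ∈ 𝐃_{k+1}` there is an open `V ⊇ sp X` on which every
activity `φ ↦ S.H g φ Z`, `Z ⊆ X`, is ℂ-differentiable and dominated by `A·e^{−R d_{k+1}(Z)}` (`hH` — route P1's H-layer datum at W1's objects;
produced from W1's named pair by §1), and the two one-run clauses hold in the constants of `G = tgeometry P.d (domCount P M (k+1))`
(`r₁ + 2G.κ₀ + 2 ≤ R`, `A·e^{5r₁+1}·G.K₀·G.ν·G.c₁ ≤ 1`), THEN `E^{(k+1)}(X; g; ·) = S.E g · X` is ANALYTIC at every point of `sp X` and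
`‖S.E g φ X‖ ≤ e·G.ν·G.c₁·G.K₀²·A·e^{−r₁ d_{k+1}(X)}` for `φ ∈ sp X`.  Proof: NE1′ `analytic_and_bounded_locE_param_of_geometry` at parameter
space `Φ` on the open `V` ((2.13) definitional), [Chae1985] on `V`, restriction to `sp X ⊆ V`. [folklore] -/
theorem analyticOnNhd_and_bound_E_of_hLayer (S : ClusterStep P 𝔸 M k) (Wk : Set (Fin (k + 1) → ℝ))
    (sp : (domSys P M (k + 1)).Dom → Set (CPair P 𝔸)) {A R r₁ : ℝ}
    (hH : ∀ g ∈ Wk, ∀ X : (domSys P M (k + 1)).Dom, ∃ V : Set (CPair P 𝔸), IsOpen V ∧ sp X ⊆ V ∧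
      (∀ Z : (domSys P M (k + 1)).Dom, Z.1 ⊆ X.1 → DifferentiableOn ℂ (fun φ => S.H g φ Z) V) ∧
      (∀ φ ∈ V, ∀ Z : (domSys P M (k + 1)).Dom, Z.1 ⊆ X.1 →
        ‖S.H g φ Z‖ ≤ A * Real.exp (-(R * (domSys P M (k + 1)).dj Z))))
    (hA : 0 ≤ A) (hr₁ : 0 ≤ r₁) (hrate : r₁ + 2 * (tgeometry P.d (domCount P M (k + 1))).κ₀ + 2 ≤ R)
    (hsmall : A * Real.exp (5 * r₁ + 1) * (tgeometry P.d (domCount P M (k + 1))).K₀ * (tgeometry P.d (domCount P M (k + 1))).ν *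
      (tgeometry P.d (domCount P M (k + 1))).c₁ ≤ 1) :
    ∀ g ∈ Wk, ∀ X : (domSys P M (k + 1)).Dom,
      AnalyticOnNhd ℂ (fun φ => S.E g φ X) (sp X) ∧
        ∀ φ ∈ sp X, ‖S.E g φ X‖ ≤
          Real.exp 1 * (tgeometry P.d (domCount P M (k + 1))).ν * (tgeometry P.d (domCount P M (k + 1))).c₁ *
            (tgeometry P.d (domCount P M (k + 1))).K₀ ^ 2 * A * Real.exp (-(r₁ * (domSys P M (k + 1)).dj X)) := by
  intro g hg X
  obtain ⟨V, hV, hsub, hdiff, hbd⟩ := hH g hg X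
  have key := analytic_and_bounded_locE_param_of_geometry (tgeometry P.d (domCount P M (k + 1)))
    (m := fun Z : (domSys P M (k + 1)).Dom => A * Real.exp (-(R * (domSys P M (k + 1)).dj Z)))
    (act := fun (φ : CPair P 𝔸) (Z : (domSys P M (k + 1)).Dom) => S.H g φ Z) (A := A) (R := R) (r₁ := r₁) X hV hA hr₁
    hrate hsmall hdiff hbd (fun Z _ => le_rfl)
  exact ⟨(analyticOnNhd_of_differentiableOn key.1 hV).mono hsub, fun φ hφ => key.2 φ (hsub hφ)⟩

/-- **THE SLACK IS FREE** (elementary): a quantity dominated by `L·a′·t` for every amplitude `a′` slightly above `a` is dominated by `L·a·t`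
(`L, t ≥ 0`).  Used to read (2.41) at the amplitude `A` of (2.38) itself after the neighbourhood extension enlarged it to `A′ > A`. [folklore] -/
theorem le_of_forall_gt_amplitude {x L t a a₁ : ℝ} (hL : 0 ≤ L) (ht : 0 ≤ t) (ha₁ : a < a₁)
    (h : ∀ a', a < a' → a' ≤ a₁ → x ≤ L * a' * t) : x ≤ L * a * t := by
  refine le_of_forall_pos_le_add fun ε hε => ?_
  rcases (mul_nonneg hL ht).eq_or_lt with hb | hb
  · have h₁ := h a₁ ha₁ le_rfl
    have e1 : L * a₁ * t = L * t * a₁ := by ring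
    have e2 : L * a * t = L * t * a := by ring
    rw [e1, ← hb, zero_mul] at h₁
    rw [e2, ← hb, zero_mul]
    linarith
  · have ha' : a < min a₁ (a + ε / (L * t)) := lt_min ha₁ (lt_add_of_pos_right a (div_pos hε hb))
    refine (h _ ha' (min_le_left _ _)).trans ?_
    calc L * min a₁ (a + ε / (L * t)) * t = L * t * min a₁ (a + ε / (L * t)) := by ring
      _ ≤ L * t * (a + ε / (L * t)) := mul_le_mul_of_nonneg_left (min_le_right _ _) hb.le
      _ = L * a * t + ε := by rw [mul_add, mul_div_assoc', mul_div_cancel_left₀ ε hb.ne']; ring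

open Classical in
/-- **§2 ∘ §1 — W1's NAMED PAIR ON ANY RESTRICTION-CLOSED TABLE, STRICT CLAUSE**: `W1.SpRestr sp` + `S.AnalyticH Wk sp` + `S.Bound238 Wk sp A R` +
the rate clause + the [KP86] clause in STRICT form `A·e^{5r₁+1}·G.K₀·G.ν·G.c₁ < 1` (the honest price of reading (2.38) on the space only: the
neighbourhood carries the majorant `A′e^{−R d}` for every `A′ > A`, the clause must survive some `A′ > A`, and the (2.41) bound is read back at `A`
by `le_of_forall_gt_amplitude`) ⟹ for every `g ∈ Wk`, `X ∈ 𝐃_{k+1}`: `E^{(k+1)}(X; g; ·)` analytic at every point of `sp X` and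
`‖S.E g φ X‖ ≤ e·G.ν·G.c₁·G.K₀²·A·e^{−r₁ d_{k+1}(X)}` on `sp X` — file 9's conclusion verbatim, at ANY table (the table of record included). [folklore] -/
theorem analyticOnNhd_and_bound_E_of_bound238_table (S : ClusterStep P 𝔸 M k) (Wk : Set (Fin (k + 1) → ℝ))
    (sp : (domSys P M (k + 1)).Dom → Set (CPair P 𝔸)) {A R r₁ : ℝ} (hrestr : W1.SpRestr sp) (han : S.AnalyticH Wk sp)
    (h238 : S.Bound238 Wk sp A R) (hA : 0 ≤ A) (hr₁ : 0 ≤ r₁)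
    (hrate : r₁ + 2 * (tgeometry P.d (domCount P M (k + 1))).κ₀ + 2 ≤ R)
    (hsmall : A * Real.exp (5 * r₁ + 1) * (tgeometry P.d (domCount P M (k + 1))).K₀ * (tgeometry P.d (domCount P M (k + 1))).ν *
      (tgeometry P.d (domCount P M (k + 1))).c₁ < 1) :
    ∀ g ∈ Wk, ∀ X : (domSys P M (k + 1)).Dom,
      AnalyticOnNhd ℂ (fun φ => S.E g φ X) (sp X) ∧
        ∀ φ ∈ sp X, ‖S.E g φ X‖ ≤
          Real.exp 1 * (tgeometry P.d (domCount P M (k + 1))).ν * (tgeometry P.d (domCount P M (k + 1))).c₁ *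
            (tgeometry P.d (domCount P M (k + 1))).K₀ ^ 2 * A * Real.exp (-(r₁ * (domSys P M (k + 1)).dj X)) := by
  -- the clause constant `c = e^{5r₁+1}·K₀·ν·c₁ ≥ 0` and an amplitude `A₁ > A` still meeting the clause
  set G := tgeometry P.d (domCount P M (k + 1)) with hG
  set c := Real.exp (5 * r₁ + 1) * G.K₀ * G.ν * G.c₁ with hc_def
  have hc : 0 ≤ c := mul_nonneg (mul_nonneg (mul_nonneg (Real.exp_nonneg _) G.K₀_nonneg) G.ν_nonneg) G.c₁_nonneg
  have hAc : A * c < 1 := by simpa only [hc_def, mul_assoc] using hsmall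
  obtain ⟨A₁, hAA₁, hA₁⟩ : ∃ A₁, A < A₁ ∧ A₁ * c ≤ 1 := by
    rcases hc.eq_or_lt with h0 | hpos
    · exact ⟨A + 1, lt_add_one A, by rw [← h0, mul_zero]; exact zero_le_one⟩
    · exact ⟨1 / c, by rwa [lt_div_iff₀ hpos], by rw [one_div_mul_cancel hpos.ne']⟩
  -- every amplitude `A′ ∈ ]A, A₁]` meets the clause, so §2 ∘ §1 applies at `A′`
  have step : ∀ A', A < A' → A' ≤ A₁ → ∀ g ∈ Wk, ∀ X : (domSys P M (k + 1)).Dom,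
      AnalyticOnNhd ℂ (fun φ => S.E g φ X) (sp X) ∧ ∀ φ ∈ sp X, ‖S.E g φ X‖ ≤
        Real.exp 1 * G.ν * G.c₁ * G.K₀ ^ 2 * A' * Real.exp (-(r₁ * (domSys P M (k + 1)).dj X)) := by
    intro A' hAA' hA'₁
    have hclause : A' * Real.exp (5 * r₁ + 1) * G.K₀ * G.ν * G.c₁ ≤ 1 :=
      calc A' * Real.exp (5 * r₁ + 1) * G.K₀ * G.ν * G.c₁ = A' * c := by simp only [hc_def, mul_assoc]
        _ ≤ A₁ * c := mul_le_mul_of_nonneg_right hA'₁ hc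
        _ ≤ 1 := hA₁
    exact analyticOnNhd_and_bound_E_of_hLayer S Wk sp (exists_nbhd_hLayer_of_analyticH_bound238 S Wk sp hrestr han h238 hAA')
      (hA.trans hAA'.le) hr₁ hrate hclause
  intro g hg X
  refine ⟨(step A₁ hAA₁ le_rfl g hg X).1, fun φ hφ => ?_⟩
  have hL : 0 ≤ Real.exp 1 * G.ν * G.c₁ * G.K₀ ^ 2 :=
    mul_nonneg (mul_nonneg (mul_nonneg (Real.exp_nonneg _) G.ν_nonneg) G.c₁_nonneg) (sq_nonneg _)
  exact le_of_forall_gt_amplitude hL (Real.exp_nonneg _) hAA₁ fun A' hAA' hA'₁ => (step A' hAA' hA'₁ g hg X).2 φ hφ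

end FromHLayer

/-! ## §3 AT `F.P K` WITH THE LOCATED NUMERALS, ANY TABLE: the tower predicates and the reading's `DecayBound`s -/

section Four

variable (F : T4Family) (K : ℕ) {𝔸 : Type*} [NormedRing 𝔸] [NormedAlgebra ℂ 𝔸] {M : ℕ}

open Classical in
/-- **§2 ∘ §1 AT `F.P K`** (d = 4 numerals `r₁ + 2·64·log 162 + 2 ≤ R`, STRICT clause `A·e^{5r₁+1}·K₀(64,8)·9·64 < 1`): W1's named pair on any
restriction-closed table ⟹ `E^{(k+1)}(X; g; ·)` analytic on `sp X` and `‖·‖ ≤ e·9·64·K₀(64,8)²·A·e^{−r₁ d_{k+1}(X)}` there. [folklore] -/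
theorem analyticOnNhd_and_bound_E_of_bound238_table_four {k : ℕ} (S : ClusterStep (F.P K) 𝔸 M k) (Wk : Set (Fin (k + 1) → ℝ))
    (sp : (domSys (F.P K) M (k + 1)).Dom → Set (CPair (F.P K) 𝔸)) {A R r₁ : ℝ} (hrestr : W1.SpRestr sp)
    (han : S.AnalyticH Wk sp) (h238 : S.Bound238 Wk sp A R) (hA : 0 ≤ A) (hr₁ : 0 ≤ r₁)
    (hrate : r₁ + 2 * (64 * Real.log 162) + 2 ≤ R) (hsmall : A * Real.exp (5 * r₁ + 1) * K₀ 64 8 * 9 * 64 < 1) :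
    ∀ g ∈ Wk, ∀ X : (domSys (F.P K) M (k + 1)).Dom,
      AnalyticOnNhd ℂ (fun φ => S.E g φ X) (sp X) ∧
        ∀ φ ∈ sp X, ‖S.E g φ X‖ ≤ Real.exp 1 * 9 * 64 * K₀ 64 8 ^ 2 * A * Real.exp (-(r₁ * (domSys (F.P K) M (k + 1)).dj X)) := by
  obtain ⟨hν, hκ₀, hK₀, hc₁⟩ := tgeometry_consts_FP F K (M := M) k
  have h := analyticOnNhd_and_bound_E_of_bound238_table S Wk sp hrestr han h238 hA hr₁ (by rw [hκ₀]; exact hrate)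
    (by rw [hK₀, hν, hc₁]; exact hsmall)
  rw [hν, hc₁, hK₀] at h
  exact h

open Classical in
/-- **`W1.TermAnalytic` ON ANY TABLE FROM THE H-LAYER DATA OF EVERY STEP** ([I] p. 263 «analytic on the space U^c_j(X, α₀, α₁)»), at `F.P K`:
per-step `AnalyticH` + `Bound238` on a restriction-closed table (NOT assumed open — the table of record qualifies), prefixes of `W` in `Wk k`,
the located rate clause and the STRICT [KP86] clause. [folklore] -/
theorem termAnalytic_of_bound238_table (S : ClusterTower (F.P K) 𝔸 M) (W : Set (ℕ → ℝ)) (Wk : (k : ℕ) → Set (Fin (k + 1) → ℝ))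
    (sp : (j : ℕ) → (domSys (F.P K) M j).Dom → Set (CPair (F.P K) 𝔸)) {A R r₁ : ℝ}
    (hW : ∀ k, ∀ g ∈ W, restrictPrefix k g ∈ Wk k) (hrestr : ∀ k, W1.SpRestr (sp (k + 1)))
    (han : ∀ k, (S k).AnalyticH (Wk k) (sp (k + 1))) (h238 : ∀ k, (S k).Bound238 (Wk k) (sp (k + 1)) A R) (hA : 0 ≤ A)
    (hr₁ : 0 ≤ r₁) (hrate : r₁ + 2 * (64 * Real.log 162) + 2 ≤ R)
    (hsmall : A * Real.exp (5 * r₁ + 1) * K₀ 64 8 * 9 * 64 < 1) :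
    TermAnalytic S W sp := by
  intro g hg j X
  cases j with
  | zero => exact analyticOnNhd_const
  | succ k =>
    exact (analyticOnNhd_and_bound_E_of_bound238_table_four F K (S k) (Wk k) (sp (k + 1)) (hrestr k) (han k) (h238 k) hA
      hr₁ hrate hsmall (restrictPrefix k g) (hW k g hg) X).1

open Classical in
/-- **`W1.TermBound118` — (1.18) — ON ANY TABLE FROM THE H-LAYER DATA OF EVERY STEP**, at `F.P K`, amplitude `E₀ = e·9·64·K₀(64,8)²·A` (file 9's),
under the STRICT clause (print: `O(1)C₃ε₁ ≤ E₀`, `termBound118_mono` of file 9 renews). [folklore] -/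
theorem termBound118_of_bound238_table (S : ClusterTower (F.P K) 𝔸 M) (W : Set (ℕ → ℝ)) (Wk : (k : ℕ) → Set (Fin (k + 1) → ℝ))
    (sp : (j : ℕ) → (domSys (F.P K) M j).Dom → Set (CPair (F.P K) 𝔸)) {A R r₁ : ℝ}
    (hW : ∀ k, ∀ g ∈ W, restrictPrefix k g ∈ Wk k) (hrestr : ∀ k, W1.SpRestr (sp (k + 1)))
    (han : ∀ k, (S k).AnalyticH (Wk k) (sp (k + 1))) (h238 : ∀ k, (S k).Bound238 (Wk k) (sp (k + 1)) A R) (hA : 0 ≤ A)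
    (hr₁ : 0 ≤ r₁) (hrate : r₁ + 2 * (64 * Real.log 162) + 2 ≤ R)
    (hsmall : A * Real.exp (5 * r₁ + 1) * K₀ 64 8 * 9 * 64 < 1) :
    TermBound118 S W sp (Real.exp 1 * 9 * 64 * K₀ 64 8 ^ 2 * A) r₁ := by
  intro g hg j X φ hφ
  cases j with
  | zero =>
    have h0 : ‖termC S 0 X g φ‖ = 0 := by rw [termC_zero, norm_zero]
    rw [h0]
    positivity
  | succ k =>
    exact (analyticOnNhd_and_bound_E_of_bound238_table_four F K (S k) (Wk k) (sp (k + 1)) (hrestr k) (han k) (h238 k) hA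
      hr₁ hrate hsmall (restrictPrefix k g) (hW k g hg) X).2 φ hφ

end Four

/-! ## §4 AT THE W1 READING's LEVEL PAIRING, ANY TABLE: L05 ∕ L06 at the reading -/

section Reading

variable {F : T4Family} {𝔸 : Type*} [NormedRing 𝔸] [NormedAlgebra ℂ 𝔸] {M k : ℕ} (R : LevelPairing F 𝔸 M k)

open Classical in
/-- **L05 AT THE READING ON ANY TABLE — `DecayBound (R.EA S) (Window γ) (e·9·64·K₀(64,8)²·A) r₁`**: run A's per-step H-layer data on a
restriction-closed table `sp` (the table of record qualifies) holding the readings `R.embA U` (`hembA`, DISPLAYED), the located rate clause and the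
STRICT [KP86] clause; `R.EA S = W1.functionalOn S R.toRunPairing R.embA` and n22-c's `decayBound_functionalOn_of_termBound118` BY NAME. [folklore] -/
theorem decayBound_EA_of_bound238_table (S : ClusterTower (F.P k) 𝔸 M)
    (sp : (j : ℕ) → (domSys (F.P k) M j).Dom → Set (CPair (F.P k) 𝔸)) {γ A Rr r₁ : ℝ}
    (hembA : ∀ (j : ℕ) (U : R.BgA) (X : (domSys (F.P k) M j).Dom), R.embA U ∈ sp j X)
    (hrestr : ∀ m, W1.SpRestr (sp (m + 1))) (han : ∀ m, (S m).AnalyticH (box γ m) (sp (m + 1)))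
    (h238 : ∀ m, (S m).Bound238 (box γ m) (sp (m + 1)) A Rr) (hA : 0 ≤ A) (hr₁ : 0 ≤ r₁)
    (hrate : r₁ + 2 * (64 * Real.log 162) + 2 ≤ Rr) (hsmall : A * Real.exp (5 * r₁ + 1) * K₀ 64 8 * 9 * 64 < 1) :
    DecayBound (R.EA S) (Window γ) (Real.exp 1 * 9 * 64 * K₀ 64 8 ^ 2 * A) r₁ :=
  decayBound_functionalOn_of_termBound118 S R.toRunPairing R.embA sp hembA
    (termBound118_of_bound238_table F k S (Window γ) (fun m => box γ m) sp (fun m _ hg => restrictPrefix_mem_box hg m) hrestr han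
      h238 hA hr₁ hrate hsmall)

open Classical in
/-- **L06 AT THE READING ON ANY TABLE — `DecayBound (R.EB S′ b) (Window γ) (e·9·64·K₀(64,8)²·A) r₁`** for every `b ∈ ]0, γ]`: run B's per-step
H-layer data on a restriction-closed table `sp′` on `F.P (k+1)` holding the readings `R.embB U` (`hembB`), the located rate clause, the STRICT clause,
and the UNPRINTED pairing datum «`d_j(X) ≤ d(pair X)`» (`hpair`, DISPLAYED as in file 9; at the pairing OF RECORD `W1.pairOfRecord` of
`Node00/RateRecordW1Maps` (p473218) it holds with equality, `W1.dj_pairOfRecord`). [folklore] -/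
theorem decayBound_EB_of_bound238_table (S' : ClusterTower (F.P (k + 1)) 𝔸 M)
    (sp' : (j : ℕ) → (domSys (F.P (k + 1)) M j).Dom → Set (CPair (F.P (k + 1)) 𝔸)) {γ A Rr r₁ : ℝ}
    (hembB : ∀ (j : ℕ) (U : R.BgB) (Y : (domSys (F.P (k + 1)) M j).Dom), R.embB U ∈ sp' j Y)
    (hpair : ∀ X : W1.Dom (F.P k) M,
      (domSys (F.P k) M X.1).dj X.2 ≤ (domSys (F.P (k + 1)) M (R.pair X).1).dj (R.pair X).2)
    (hrestr : ∀ m, W1.SpRestr (sp' (m + 1))) (han : ∀ m, (S' m).AnalyticH (box γ m) (sp' (m + 1)))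
    (h238 : ∀ m, (S' m).Bound238 (box γ m) (sp' (m + 1)) A Rr) (hA : 0 ≤ A) (hr₁ : 0 ≤ r₁)
    (hrate : r₁ + 2 * (64 * Real.log 162) + 2 ≤ Rr) (hsmall : A * Real.exp (5 * r₁ + 1) * K₀ 64 8 * 9 * 64 < 1) {b : ℝ}
    (hb : b ∈ Ioc (0 : ℝ) γ) :
    DecayBound (R.EB S' b) (Window γ) (Real.exp 1 * 9 * 64 * K₀ 64 8 ^ 2 * A) r₁ := by
  have h118 := termBound118_of_bound238_table F (k + 1) S' (Window γ) (fun m => box γ m) sp'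
    (fun m _ hg => restrictPrefix_mem_box hg m) hrestr han h238 hA hr₁ hrate hsmall
  have hE₀ : 0 ≤ Real.exp 1 * 9 * 64 * K₀ 64 8 ^ 2 * A := by positivity
  intro g hg U X
  have h := h118 (prependCoupling b g) (prependCoupling_mem_window hb hg) (R.pair X).1 (R.pair X).2 (R.embB U) (hembB _ U _)
  rw [LevelPairing.EB_apply, LevelPairing.carriers_d]
  calc |(functionalC S' (prependCoupling b g) (R.embB U) (R.pair X)).re|
      ≤ ‖functionalC S' (prependCoupling b g) (R.embB U) (R.pair X)‖ := Complex.abs_re_le_norm _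
    _ ≤ Real.exp 1 * 9 * 64 * K₀ 64 8 ^ 2 * A * Real.exp (-(r₁ * (domSys (F.P (k + 1)) M (R.pair X).1).dj (R.pair X).2)) := h
    _ ≤ Real.exp 1 * 9 * 64 * K₀ 64 8 ^ 2 * A * Real.exp (-(r₁ * (domSys (F.P k) M X.1).dj X.2)) :=
        mul_le_mul_of_nonneg_left (Real.exp_le_exp.2 (neg_le_neg (mul_le_mul_of_nonneg_left (hpair X) hr₁))) hE₀

/-! ### §4b The same at the reading data `W1.ReadingData` of one construction (the U3 objects `D.u3Objects γ`, per run length; `rfl` faces) -/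

open Classical in
/-- **L05 AT THE U3 OBJECTS OF THE W1 READING**: for the reading data `D` of one construction and run length `k`, run A's per-step H-layer data (on any
restriction-closed table holding the run-A readings, located rate clause, STRICT [KP86] clause) ⟹ `DecayBound ((D.u3Objects γ).EA k) (Window γ)
(e·9·64·K₀(64,8)²·A) r₁` (`ReadingData.u3Objects_EA`: `EA k = W1.functionalOn (D.S k) _ embA`, `rfl`). [folklore] -/
theorem decayBound_u3Objects_EA_of_bound238_table (D : ReadingData F 𝔸 M) (γ : ℝ) (k : ℕ)
    (sp : (j : ℕ) → (domSys (F.P k) M j).Dom → Set (CPair (F.P k) 𝔸)) {A Rr r₁ : ℝ}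
    (hembA : ∀ (j : ℕ) (U : (D.pairing k).BgA) (X : (domSys (F.P k) M j).Dom), (D.pairing k).embA U ∈ sp j X)
    (hrestr : ∀ m, W1.SpRestr (sp (m + 1))) (han : ∀ m, (D.S k m).AnalyticH (box γ m) (sp (m + 1)))
    (h238 : ∀ m, (D.S k m).Bound238 (box γ m) (sp (m + 1)) A Rr) (hA : 0 ≤ A) (hr₁ : 0 ≤ r₁)
    (hrate : r₁ + 2 * (64 * Real.log 162) + 2 ≤ Rr) (hsmall : A * Real.exp (5 * r₁ + 1) * K₀ 64 8 * 9 * 64 < 1) :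
    DecayBound ((D.u3Objects γ).EA k) (Window γ) (Real.exp 1 * 9 * 64 * K₀ 64 8 ^ 2 * A) r₁ :=
  decayBound_EA_of_bound238_table (D.pairing k) (D.S k) sp hembA hrestr han h238 hA hr₁ hrate hsmall

open Classical in
/-- **L06 AT THE U3 OBJECTS OF THE W1 READING**: for run length `k` and every member `b ∈ ]0, γ]`, run B's per-step H-layer data (tower `D.S (k+1)` on
any restriction-closed table on `F.P (k+1)` holding the run-B readings, located rate clause, STRICT clause, pairing datum `hpair` displayed) ⟹
`DecayBound ((D.u3Objects γ).EB k b) (Window γ) (e·9·64·K₀(64,8)²·A) r₁` (`ReadingData.u3Objects_EB_apply`, `rfl`). [folklore] -/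
theorem decayBound_u3Objects_EB_of_bound238_table (D : ReadingData F 𝔸 M) (γ : ℝ) (k : ℕ)
    (sp' : (j : ℕ) → (domSys (F.P (k + 1)) M j).Dom → Set (CPair (F.P (k + 1)) 𝔸)) {A Rr r₁ : ℝ}
    (hembB : ∀ (j : ℕ) (U : (D.pairing k).BgB) (Y : (domSys (F.P (k + 1)) M j).Dom), (D.pairing k).embB U ∈ sp' j Y)
    (hpair : ∀ X : W1.Dom (F.P k) M,
      (domSys (F.P k) M X.1).dj X.2 ≤ (domSys (F.P (k + 1)) M ((D.pairing k).pair X).1).dj ((D.pairing k).pair X).2)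
    (hrestr : ∀ m, W1.SpRestr (sp' (m + 1))) (han : ∀ m, (D.S (k + 1) m).AnalyticH (box γ m) (sp' (m + 1)))
    (h238 : ∀ m, (D.S (k + 1) m).Bound238 (box γ m) (sp' (m + 1)) A Rr) (hA : 0 ≤ A) (hr₁ : 0 ≤ r₁)
    (hrate : r₁ + 2 * (64 * Real.log 162) + 2 ≤ Rr) (hsmall : A * Real.exp (5 * r₁ + 1) * K₀ 64 8 * 9 * 64 < 1) {b : ℝ}
    (hb : b ∈ Ioc (0 : ℝ) γ) :
    DecayBound ((D.u3Objects γ).EB k b) (Window γ) (Real.exp 1 * 9 * 64 * K₀ 64 8 ^ 2 * A) r₁ :=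
  decayBound_EB_of_bound238_table (D.pairing k) (D.S (k + 1)) sp' hembB hpair hrestr han h238 hA hr₁ hrate hsmall hb

end Reading


end Summit.QuantumFields.YangMills.BalabanUVNodes.N18HLayerW1ConfigRecord

end
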